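import Summits.BirchSwinnertonDyer.BirchSwinnertonDyer.Theorems.KatoDescentPotSupersingularASideCountPPart
import HarnessLib

/-!
# Brick (b) of crux M's level-0 ledger in PAIRING form: the number of local Kummer classes of `W(ℚ_p)` at level `p^k` orthogonal to the
# zeta line under the local Tate pairing — `#(𝓚_k ⊓ {}^⊥B_k(ℤ_p y₀)) ∣ #W(ℚ_p)[p^k] · p^e` — is equivalent data to the counting form
# `p^k ∣ [B_k(ℤ_p y₀) : B_k(ℤ_p y₀) ⊓ 𝓚_k^⊥] · p^e`, and yields the level-0 count of part 54
# (route `KatoDescentPotSupersingular` / `…Tame…`, crux M = stmt-BirchSwinnertonDyer-19196; route-free helper)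

Seat `bsd-potss-rkm` g20 (prover; cell `bsd-potss`), item stmt-BirchSwinnertonDyer-19196 (`--supports … --as helper`; closes nothing).
HONEST FRAMING: BSD is not proved by any of this; nothing is booked; theorems only (no definition, no named fact).  CONDITIONAL (part 54) on the
named fact `poitouTate_selmerStructure_duality ℚ` and on the displayed brick (b‴).

## Why this form

Kato's Lemma 14.18 (with the value of the dual exponential, Thm. 12.5 (1) / Lemma 13.10) is proved through an EXPLICIT RECIPROCITY LAW: the local
Tate pairing of the zeta class `red_k y₀` with the Kummer class `δ_k(P)` of a local point `P ∈ W(ℚ_p)` is `p^{-k}·Tr(log_ω(P)·exp*_ω(y₀))`.  What such a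
computation delivers at level `p^k` is therefore the NUMBER OF LOCAL KUMMER CLASSES ORTHOGONAL TO THE ZETA LINE,
`#(𝓚_k ⊓ {}^⊥B_k(ℤ_p y₀))` (`{}^⊥` = left annihilator under `⟨·,·⟩_k = inv_p(· ∪ ·)`), namely `#W(ℚ_p)[p^k]·p^e` for `k ≫ 0` with
`e = a + v_p(λ(0)) + t_p − v_p(c_p)` (the image of `log_ω` is `p^{t_p − v_p(c_p)}ℤ_p`, bsd-addord's `LocalIndexSkeletonProofs`).  By the perfect-pairing
count of part 32 (`natCard_inf_annLeft_mul_relIndex`: `#(𝓚 ⊓ {}^⊥Y)·[Y : Y ⊓ 𝓚^⊥] = #𝓚`) and `#𝓚_k = #W(ℚ_p)[p^k]·p^k` (part 7), this is the same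
information as the counting form (b″) of parts 52–54:

* `dvd_relIndex_mul_of_natCard_inf_annLeft_dvd` — abstract: for a perfect `ℤ/n`-pairing of finite groups, `#K = t·q` and `#(K ⊓ {}^⊥Y) ∣ t·c` give
  `q ∣ [Y : Y ⊓ K^⊥]·c`;
* `pow_dvd_relIndex_mul_pow_of_kummerOrthogonalCount_dvd` — at `v_p`, level `p^k`, family `inv` perfect at `v_p`:
  `#(𝓚_k ⊓ {}^⊥Y) ∣ #W(ℚ_p)[p^k]·p^e ⟹ p^k ∣ [Y : Y ⊓ 𝓚_k^⊥]·p^e` for every `Y ≤ H¹(ℚ_p, E[p^k]^D)`;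
* **`tamagawa_mul_sha_mul_index_le_ppart_of_kummerOrthogonalCount`** — part 54 with (b‴) «`#(𝓚_k ⊓ {}^⊥B_k(ℤ_p y₀)) ∣ #W(ℚ_p)[p^k]·p^e` for `k ≫ 0` and
  all auxiliary data» in place of (b″): **`p^{v_p(Tam W)}·#Ш(W)[p^∞]·[A : ℤ_p y₀] ≤ p^{v_p(c_p)}·#Sel_str^{ur}(W[p^∞])·p^e·(p^{v_p #W(ℚ)_tors})²`**.

References: K. Kato, Astérisque 295 (2004), Lemma 14.18 and its proof (pp. 247–248), Prop. 14.16 (2) (pp. 244–245), Thm. 16.6 / Prop. 14.21 (explicit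
reciprocity) [Kato2004Asterisque]; S. Bloch, K. Kato (1990) Prop. 3.8, Ex. 3.11 [BlochKato1990]; J. S. Milne, *ADT* I Prop. 0.19, Cor. 2.3, Lemma 3.3
[MilneADT2006].
-/

-- the summit and its single problem are both named `BirchSwinnertonDyer` (registry layout D-0017)
set_option linter.dupNamespace false
set_option autoImplicit false

noncomputable section

open scoped Classical ContRepresentation NumberField AddSubgroup
open CategoryTheory Function Field NumberField IsDedekindDomain WeierstrassCurve
open Literature.NumberTheory.EllipticCurves Literature.NumberTheory.GaloisRepresentations
  Literature.NumberTheory.GaloisRepresentations.DiscreteGaloisModule Literature.NumberTheory.GaloisCohomology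
open Literature.NumberTheory.EllipticCurves.Kato2004 Literature.NumberTheory.EllipticCurves.Kato2004.EulerSystemValues
open Summit.BirchSwinnertonDyer.Rank1Residual.X11b.Levels Summit.BirchSwinnertonDyer.Rank1Residual.X11b.LocBridge
  Summit.BirchSwinnertonDyer.Rank1Residual.X11b.LevelKummer Summit.BirchSwinnertonDyer.Rank1Residual.X11b.FiniteDuality
  Summit.BirchSwinnertonDyer.Rank1Residual.X11b.AcSelmer
open Summit.BirchSwinnertonDyer.Rank1Residual.GaloisImage
open Summit.BirchSwinnertonDyer.BirchSwinnertonDyer.Theorems.KummerTowerOrthogonal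
open Summit.BirchSwinnertonDyer.BirchSwinnertonDyer.Theorems.ASideJunction

namespace Summit.BirchSwinnertonDyer.BirchSwinnertonDyer.Theorems.KatoFiniteLevelCount

/-! ## §1 The abstract conversion -/

section Abstract

variable {A : Type*} [AddCommGroup A] {B : Type*} [AddCommGroup B] {n : ℕ} [Finite A] [Finite B] [NeZero n]

/-- **`#K = t·q` and `#(K ⊓ {}^⊥Y) ∣ t·c` give `q ∣ [Y : Y ⊓ K^⊥]·c`** for a perfect `ℤ/n`-pairing `b : A × B → ℤ/n` of finite groups killed by `n`
(`#(K ⊓ {}^⊥Y)·[Y : Y ⊓ K^⊥] = #K`, part 32). [cite: MilneADT2006, Ch. I §0, Prop. 0.19] -/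
theorem dvd_relIndex_mul_of_natCard_inf_annLeft_dvd (hA : ∀ x : A, n • x = 0) (hB : ∀ y : B, n • y = 0) (b : A →+ B →+ ZMod n)
    (hb : Bijective b) (hflip : Bijective b.flip) (K : AddSubgroup A) (Y : AddSubgroup B) {t q c : ℕ}
    (hK : Nat.card K = t * q) (hc : Nat.card ↥(K ⊓ annLeft b Y) ∣ t * c) :
    q ∣ (Y ⊓ annRight b K).relIndex Y * c := by
  have h := natCard_inf_annLeft_mul_relIndex hA hB b hb hflip K Y
  obtain ⟨w, hw⟩ := hc
  have hpos : 0 < Nat.card ↥(K ⊓ annLeft b Y) := Nat.card_pos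
  refine ⟨w, Nat.eq_of_mul_eq_mul_left hpos ?_⟩
  calc Nat.card ↥(K ⊓ annLeft b Y) * ((Y ⊓ annRight b K).relIndex Y * c)
      = Nat.card K * c := by rw [← mul_assoc, h]
    _ = q * (t * c) := by rw [hK]; ring
    _ = Nat.card ↥(K ⊓ annLeft b Y) * (q * w) := by rw [hw]; ring

end Abstract

/-! ## §2 At `v_p`, level `p^k`: pairing form ⟹ counting form -/

section Local

variable (W : WeierstrassCurve ℚ) [W.IsElliptic] (p k j : ℕ) [Fact p.Prime]

/-- **`#(𝓚_k ⊓ {}^⊥Y) ∣ #W(ℚ_p)[p^k]·p^e ⟹ p^k ∣ [Y : Y ⊓ 𝓚_k^⊥]·p^e`** at `v_p`, for the local Kummer condition `𝓚_k` at level `p^k`, the local Tate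
pairing `⟨·,·⟩ = inv_p(· ∪_{ev} ·)` of a family `inv` at level `p^j p^k` PERFECT at `v_p`, and any `Y ≤ H¹(ℚ_p, E[p^k]^D)`:
§1 with `#𝓚_k = #W(ℚ_p)[p^k]·p^k` (part 7 `natCard_kummerSelmerStructure_primePlace`). [cite: MilneADT2006, Ch. I, Cor. 2.3 and Lemma 3.3]
[cite: Kato2004Asterisque, Lemma 14.18 (pp. 247–248)] -/
theorem pow_dvd_relIndex_mul_pow_of_kummerOrthogonalCount_dvd (inv : LocalInvariants ℚ (p ^ j * p ^ k)) (hperf : inv.IsPerfect)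
    [Finite (geomTorsion W ((p ^ k : ℕ) : ℤ))]
    (Y : AddSubgroup (galoisCohomology
      (((W.torsionGaloisModule ((p ^ k : ℕ) : ℤ)).tateDual (p ^ j * p ^ k)).toLocal (Sum.inr (primePlace p))) 1)) (e : ℕ)
    (hc : Nat.card ↥(W.kummerSelmerStructure ((p ^ k : ℕ) : ℤ) (Sum.inr (primePlace p)) ⊓
          annLeft (localTatePairingZMod (W.torsionGaloisModule ((p ^ k : ℕ) : ℤ)) (p ^ j * p ^ k)
            (Sum.inr (primePlace p)) (inv (Sum.inr (primePlace p)))) Y) ∣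
        Nat.card (nsmulAddMonoidHom (p ^ k) : (W.baseChange ((primePlace p).adicCompletion ℚ)).toAffine.Point →+ _).ker * p ^ e) :
    p ^ k ∣ (Y ⊓ annRight (localTatePairingZMod (W.torsionGaloisModule ((p ^ k : ℕ) : ℤ)) (p ^ j * p ^ k)
        (Sum.inr (primePlace p)) (inv (Sum.inr (primePlace p))))
        (W.kummerSelmerStructure ((p ^ k : ℕ) : ℤ) (Sum.inr (primePlace p)))).relIndex Y * p ^ e := by
  have hp : p.Prime := Fact.out
  haveI := neZero_pow p j; haveI := neZero_pow p k
  haveI : Finite (galoisCohomology ((W.torsionGaloisModule ((p ^ k : ℕ) : ℤ)).toLocal (Sum.inr (primePlace p))) 1) :=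
    finite_galoisCohomology_one_toLocal _ _
  haveI : Finite (galoisCohomology
      (((W.torsionGaloisModule ((p ^ k : ℕ) : ℤ)).tateDual (p ^ j * p ^ k)).toLocal (Sum.inr (primePlace p))) 1) :=
    finite_galoisCohomology_one_tateDual_toLocal _ _ _
  have hM : ∀ x : geomTorsion W ((p ^ k : ℕ) : ℤ), (p ^ j * p ^ k) • x = 0 := fun x => by
    rw [mul_smul, pow_nsmul_geomTorsion_eq_zero, smul_zero]
  have hA : ∀ x : galoisCohomology ((W.torsionGaloisModule ((p ^ k : ℕ) : ℤ)).toLocal (Sum.inr (primePlace p))) 1,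
      (p ^ j * p ^ k) • x = 0 := galoisCohomology.nsmul_eq_zero_of_forall _ hM
  have hB : ∀ y : galoisCohomology
      (((W.torsionGaloisModule ((p ^ k : ℕ) : ℤ)).tateDual (p ^ j * p ^ k)).toLocal (Sum.inr (primePlace p))) 1, (p ^ j * p ^ k) • y = 0 :=
    galoisCohomology.nsmul_eq_zero_of_forall _ fun f => DiscreteGaloisModule.TateDual.nsmul_eq_zero f
  obtain ⟨hb1, hb2⟩ := (hperf (primePlace p)).2 (W.torsionGaloisModule ((p ^ k : ℕ) : ℤ)) hM
  exact dvd_relIndex_mul_of_natCard_inf_annLeft_dvd hA hB _ hb1 hb2 _ Y (natCard_kummerSelmerStructure_primePlace W p k) hc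

end Local

/-! ## §3 The count from the pairing form -/

section Count

variable (W : WeierstrassCurve ℚ) [W.IsElliptic] (p : ℕ) [Fact p.Prime] [ContinuousSMul ℤ_[p] (W.tateModule p)]
  (𝓤inf 𝓢inf : SelmerStructure (primaryGaloisModule W p))

/-- **THE LEVEL-0 COUNT OF CRUX M FROM BRICK (b) IN PAIRING FORM:
`p^{v_p(Tam W)}·#Ш(W)[p^∞]·[A : ℤ_p y₀] ≤ p^{v_p(c_p)}·#Sel_str^{ur}(W[p^∞])·p^e·(p^{v_p #W(ℚ)_tors})²`** under (b‴) «for `k ≫ 0` and all auxiliary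
data, the number of level-`p^k` local Kummer classes at `p` orthogonal to the zeta line divides `#W(ℚ_p)[p^k]·p^e`» (Kato Lemma 14.18 via the explicit
reciprocity law; displayed, NOT proved) and the named fact `poitouTate_selmerStructure_duality ℚ`; all other hypotheses as part 54.
[cite: Kato2004Asterisque, Prop. 14.16 and its proof (pp. 244–245), Lemma 14.18 (pp. 247–248)] [cite: MilneADT2006, Ch. I, Prop. 0.19, Thm. 4.10 (b)] -/
theorem tamagawa_mul_sha_mul_index_le_ppart_of_kummerOrthogonalCount (hPT : poitouTate_selmerStructure_duality ℚ) (hodd : p ≠ 2) (T : Finset (HeightOneSpectrum (𝓞 ℚ)))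
    (hpT : primePlace p ∈ T) (hT : ∀ v : HeightOneSpectrum (𝓞 ℚ), v ∉ T → W.HasGoodReductionAt v)
    [Finite W.toAffine.Point] [Finite (AddCommGroup.primaryComponent (↥W.sha) p)]
    (hUp : 𝓤inf (Sum.inr (primePlace p)) = ⊤)
    (hUur : ∀ v : HeightOneSpectrum (𝓞 ℚ), v ≠ primePlace p →
      𝓤inf (Sum.inr v) = unramifiedSubgroup (GaloisRep.toLocal v (primaryGaloisModule W p)) 1)
    (hUinl : ∀ w : InfinitePlace ℚ, 𝓤inf (Sum.inl w) = ⊤)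
    (hSp : 𝓢inf (Sum.inr (primePlace p)) = ⊥)
    (hSur : ∀ v : HeightOneSpectrum (𝓞 ℚ), v ≠ primePlace p →
      𝓢inf (Sum.inr v) = unramifiedSubgroup (GaloisRep.toLocal v (primaryGaloisModule W p)) 1)
    (hSinl : ∀ w : InfinitePlace ℚ, 𝓢inf (Sum.inl w) = ⊤)
    (y₀ : H1 (tateRep W p) ⊤) (hy₀ : y₀ ∈ integralH1 (tateRep W p) p ⊤) (N : ℕ)
    (hN : ∀ a ∈ integralH1 (tateRep W p) p ⊤, ((p ^ N : ℕ) : ℤ) • a ∈ (ℤ_[p] ∙ y₀).toAddSubgroup) (e : ℕ)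
    (hb : ∃ k₁ : ℕ, ∀ k : ℕ, k₁ ≤ k → ∀ j : ℕ,
      haveI := neZero_pow p j; haveI := neZero_pow p k
      haveI : Finite (geomTorsion W ((p ^ k : ℕ) : ℤ)) := finite_geomTorsion_pow W p k
      ∀ (inv : LocalInvariants ℚ (p ^ j * p ^ k)), inv.SumLocalTermEqZero → inv.IsPerfect →
      ∀ (ε : geomTorsion W ((p ^ j * p ^ k : ℕ) : ℤ) → geomTorsion W ((p ^ j * p ^ k : ℕ) : ℤ) → AlgebraicClosure ℚ)
        (hμ : ∀ S T, ε S T ^ (p ^ j * p ^ k) = 1)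
        (hadd₁ : ∀ S₁ S₂ T, ε (S₁ + S₂) T = ε S₁ T * ε S₂ T)
        (hadd₂ : ∀ S T₁ T₂, ε S (T₁ + T₂) = ε S T₁ * ε S T₂)
        (hgal : ∀ (σ : absoluteGaloisGroup ℚ) (S T : geomTorsion W ((p ^ j * p ^ k : ℕ) : ℤ)), σ • ε S T = ε (σ • S) (σ • T)),
      Nat.card ↥(W.kummerSelmerStructure ((p ^ k : ℕ) : ℤ) (Sum.inr (primePlace p)) ⊓
          annLeft (localTatePairingZMod (W.torsionGaloisModule ((p ^ k : ℕ) : ℤ)) (p ^ j * p ^ k)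
            (Sum.inr (primePlace p)) (inv (Sum.inr (primePlace p))))
            ((((ℤ_[p] ∙ y₀).toAddSubgroup.map
                  (((galoisCohomology.map (W.torsionInclusion (intPow_dvd_natCast_pow p k)) 1).comp
                      (ofTopSubgroup (W.torsionGaloisModule ((p : ℤ) ^ k)).toTopRep 1).hom.toLinearMap.toAddMonoidHom).comp
                    (reduceH1Pk W p k ⊤))).map
                  (galoisCohomology.map (DiscreteGaloisModule.pairingDualIntertwining
                    (ρ₁ := W.torsionGaloisModule ((p ^ k : ℕ) : ℤ)) (ρ₂ := W.torsionGaloisModule ((p ^ k : ℕ) : ℤ))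
                    (B := descendHom W (p ^ j) (p ^ k) ε hμ hadd₁ hadd₂)
                    (descendHom_smul W (p ^ j) (p ^ k) ε hμ hadd₁ hadd₂ hgal)) 1)).map
                (galoisCohomology.localization ((W.torsionGaloisModule ((p ^ k : ℕ) : ℤ)).tateDual (p ^ j * p ^ k))
                  (Sum.inr (primePlace p)) 1))) ∣
        Nat.card (nsmulAddMonoidHom (p ^ k) : (W.baseChange ((primePlace p).adicCompletion ℚ)).toAffine.Point →+ _).ker * p ^ e) :
    p ^ padicValNat p W.tamagawaProduct * Nat.card (AddCommGroup.primaryComponent (↥W.sha) p) *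
        (ℤ_[p] ∙ y₀).toAddSubgroup.relIndex (integralH1 (tateRep W p) p ⊤).toAddSubgroup ≤
      p ^ padicValNat p ((W.baseChange ((primePlace p).adicCompletion ℚ)).localTamagawaNumber
          ((primePlace p).adicCompletionIntegers ℚ)) * Nat.card 𝓢inf.selmerGroup * p ^ e * (p ^ padicValNat p W.torsionOrder) ^ 2  := by
  obtain ⟨k₁, hb⟩ := hb
  refine tamagawa_mul_sha_mul_index_le_ppart_of_zetaLineIndex W p 𝓤inf 𝓢inf hPT hodd T hpT hT hUp hUur hUinl hSp hSur hSinl y₀ hy₀ N hN e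
    ⟨k₁, fun k hk j => ?_⟩
  intro inv hsum hperf ε hμ hadd₁ hadd₂ hgal
  haveI := neZero_pow p j; haveI := neZero_pow p k
  haveI : Finite (geomTorsion W ((p ^ k : ℕ) : ℤ)) := finite_geomTorsion_pow W p k
  exact pow_dvd_relIndex_mul_pow_of_kummerOrthogonalCount_dvd W p k j inv hperf _ e (hb k hk j inv hsum hperf ε hμ hadd₁ hadd₂ hgal)

end Count

end Summit.BirchSwinnertonDyer.BirchSwinnertonDyer.Theorems.KatoFiniteLevelCount

end
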